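import Summits.HodgeConjecture.HodgeConjecture.Theses.PeriodDeficiency
import Literature.AlgebraicGeometry.HodgeTheory.QbarFamilyLocalSystem
import Literature.AlgebraicGeometry.HodgeTheory.DivisorClassesFiniteEtaleBaseChange
import HarnessLib

/-!
# Route PeriodDeficiency — `QbarGenericIsHodgeGeneric` (stmt-HodgeConjecture-11595), line `registered`: stub `stub_mtRankAt_bounded`

The registered stub `stub_mtRankAt_bounded` (stub 1a) of the line skeleton
`Cruxes/QbarGenericIsHodgeGeneric/Lines/birth.lean`, proved UNCONDITIONALLY.

**Statement.** For `σ : ℚ̄ →+* ℂ`, a `ℚ̄`-morphism `f₀ : 𝒳₀ ⟶ S₀` with `S₀` smooth and irreducible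
over `ℚ̄`, and a geometric VHS datum `D` over the complexification `f₀ ⊗_σ ℂ` (with finite
rational fibres), the Mumford–Tate ranks `D.mtRankAt y = dim_ℚ 𝔪𝔱(V_y)` are bounded on `S(ℂ)`,
`S = S₀ ⊗_σ ℂ`.

**Proof.**
1. `S` is irreducible (`ℚ̄` is algebraically closed, `S₀` smooth irreducible:
   `irreducibleSpace_baseChangeHom_left`), smooth over `ℂ` (`smooth_baseChangeHom_hom`, hence
   locally of finite type), and smooth of one relative dimension `d`
   (`exists_smoothOfRelativeDimension_baseChangeHom`).
2. Hence `S(ℂ)` is connected (SGA1 XII Prop. 2.4, the tree's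
   `connectedSpace_complexPoints_of_irreducibleSpace`) and, being a topological manifold, path
   connected (`pathConnectedSpace_complexPoints_of_smoothOfRelativeDimension`).
3. Parallel transport in the local system `D.V` along a path is a linear isomorphism, so the rank
   `dim_ℚ V_y` is constant on `S(ℂ)` (`LocalSystem.rank_eq_of_joined`), and
   `mtRankAt y = dim_ℚ 𝔪𝔱(V_y) ≤ dim_ℚ End(V_y) = (dim_ℚ V_y)²` (`Submodule.finrank_le`,
   `Module.finrank_linearMap`). If `S(ℂ) = ∅` the bound `0` works vacuously.

Everything used is proved in the tree or in Mathlib; no named fact is assumed. (`B.IsClassical` is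
not needed.)

## References

* G. Baldi, B. Klingler, E. Ullmo, On the distribution of the Hodge locus, Invent. Math. 235
  (2024), §3.2 (Hodge-generic points, `dim MT` maximal). [BaldiKlinglerUllmo2024]
* A. Grothendieck, SGA 1, Exp. XII Prop. 2.4 (irreducible ⟹ connected analytification). [SGA1]
* C. Voisin, Hodge Theory and Complex Algebraic Geometry I (2002), §9.2 (local systems, transport). [VoisinHodgeI2002]
-/

noncomputable section

-- every declaration of this problem lives in `Summit.HodgeConjecture.HodgeConjecture.…` (summit = sub-problem)
set_option linter.dupNamespace false

open CategoryTheory AlgebraicGeometry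
open Literature.AlgebraicGeometry.Motives Literature.AlgebraicGeometry.HodgeTheory

namespace Summit.HodgeConjecture.HodgeConjecture.Theorems

/-- **The dimension of the Mumford–Tate Lie algebra is at most `(dim V)²`**: `𝔪𝔱(H) ⊆ End(V)` and
`dim_ℚ End(V) = (dim_ℚ V)²`. [folklore] -/
theorem mtRank_le_finrank_mul_finrank [HodgeTensorFacts.{0, 0}] {V : Type} [AddCommGroup V]
    [Module ℚ V] [Module.Finite ℚ V] {n : ℤ} (H : HodgeStructure V n) :
    H.mtRank ≤ Module.finrank ℚ V * Module.finrank ℚ V := by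
  calc H.mtRank = Module.finrank ℚ H.mumfordTateLieAlgebra := rfl
    _ ≤ Module.finrank ℚ (Module.End ℚ V) := Submodule.finrank_le _
    _ = Module.finrank ℚ V * Module.finrank ℚ V := Module.finrank_linearMap ℚ ℚ V V

/-- **The Mumford–Tate ranks of a VHS datum on a path-connected base are bounded** by
`(dim V_{y₀})²` for any base point `y₀`: transport along a path joining `y` to `y₀` is a linear
isomorphism `V_y ≃ V_{y₀}` (`LocalSystem.rank_eq_of_joined`), and
`mtRankAt y = dim 𝔪𝔱(V_y) ≤ (dim V_y)²`. [cite: BaldiKlinglerUllmo2024, §3.2] -/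
theorem mtRankAt_le_of_pathConnectedSpace [HodgeTensorFacts.{0, 0}] {S : Type} [TopologicalSpace S]
    [PathConnectedSpace S] {n : ℤ} (D : VHSData S n) [∀ s, Module.Finite ℚ (D.V.fiber s)]
    (y₀ y : S) :
    D.mtRankAt y ≤ Module.finrank ℚ (D.V.fiber y₀) * Module.finrank ℚ (D.V.fiber y₀) := by
  have hrk : Module.finrank ℚ (D.V.fiber y) = Module.finrank ℚ (D.V.fiber y₀) :=
    LocalSystem.rank_eq_of_joined D.V (PathConnectedSpace.joined y y₀)
  rw [← hrk]
  exact mtRank_le_finrank_mul_finrank (D.hodge y)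

/-- **The complex points of the complexification `S₀ ⊗_σ ℂ` of a smooth irreducible `ℚ̄`-scheme
form a path-connected space** (analytic topology): `S₀ ⊗_σ ℂ` is irreducible (`ℚ̄` algebraically
closed; `irreducibleSpace_baseChangeHom_left`), smooth — hence locally of finite type — over `ℂ`
(`smooth_baseChangeHom_hom`) and smooth of one relative dimension
(`exists_smoothOfRelativeDimension_baseChangeHom`); irreducible complex varieties are connected in
the complex topology (SGA1 XII Prop. 2.4, `connectedSpace_complexPoints_of_irreducibleSpace`), and a
connected topological manifold is path connected
(`pathConnectedSpace_complexPoints_of_smoothOfRelativeDimension`). [cite: SGA1, Exp. XII Prop. 2.4] -/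
theorem pathConnectedSpace_complexPoints_baseChangeHom_of_smooth (σ : AlgebraicClosure ℚ →+* ℂ)
    (S₀ : SchemeOver (AlgebraicClosure ℚ)) [IrreducibleSpace S₀.left] [Smooth S₀.hom] :
    PathConnectedSpace (ComplexPoints ((baseChangeHom σ).obj S₀)) := by
  haveI : IrreducibleSpace ((baseChangeHom σ).obj S₀).left := irreducibleSpace_baseChangeHom_left σ
  haveI : Smooth ((baseChangeHom σ).obj S₀).hom := smooth_baseChangeHom_hom σ
  obtain ⟨d, hd⟩ := exists_smoothOfRelativeDimension_baseChangeHom σ S₀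
  haveI := hd
  haveI : ConnectedSpace (ComplexPoints ((baseChangeHom σ).obj S₀)) :=
    connectedSpace_complexPoints_of_irreducibleSpace _
  exact pathConnectedSpace_complexPoints_of_smoothOfRelativeDimension _ d

/-- STUB 1a of the line skeleton `Cruxes/QbarGenericIsHodgeGeneric/Lines/birth.lean`, PROVED —
**the Mumford–Tate ranks are bounded on `S(ℂ)`.** For `D` a geometric VHS datum over `f₀ ⊗_σ ℂ`
with `S₀` smooth irreducible over `ℚ̄` (and finite rational fibres): `∃ C, ∀ y, D.mtRankAt y ≤ C`.
`S(ℂ)` is path connected (`pathConnectedSpace_complexPoints_baseChangeHom_of_smooth`), transport in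
the local system `D.V` is a linear isomorphism (`LocalSystem.rank_eq_of_joined`), so
`dim V_y = dim V_{y₀}` and `mtRankAt y = dim 𝔪𝔱(V_y) ≤ dim End(V_y) = (dim V_{y₀})²`
(`Submodule.finrank_le`, `Module.finrank_linearMap`); for `S(ℂ) = ∅` take `C = 0`.
(`B.IsClassical` is not needed.) [cite: BaldiKlinglerUllmo2024, §3.2]
[cite: SGA1, Exp. XII Prop. 2.4] -/
theorem stub_mtRankAt_bounded :
    ∀ (B : BettiHodgeData ℂ), B.IsClassical → ∀ [HodgeTensorFacts.{0, 0}]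
      (σ : AlgebraicClosure ℚ →+* ℂ) ⦃𝒳₀ S₀ : SchemeOver (AlgebraicClosure ℚ)⦄ (f₀ : 𝒳₀ ⟶ S₀)
      (n i : ℕ) (D : GeometricVHSData B ((baseChangeHom σ).map f₀) n i)
      [∀ s, Module.Finite ℚ (D.V.fiber s)],
      IrreducibleSpace S₀.left → AlgebraicGeometry.Smooth S₀.hom →
      ∃ C : ℕ, ∀ y : ComplexPoints ((baseChangeHom σ).obj S₀), D.mtRankAt y ≤ C := by
  intro B _ _ σ 𝒳₀ S₀ f₀ n i D _ hirr hsm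
  haveI := hirr
  haveI := hsm
  haveI := pathConnectedSpace_complexPoints_baseChangeHom_of_smooth σ S₀
  rcases isEmpty_or_nonempty (ComplexPoints ((baseChangeHom σ).obj S₀)) with h | ⟨⟨y₀⟩⟩
  · exact ⟨0, fun y => (IsEmpty.false y).elim⟩
  · exact ⟨Module.finrank ℚ (D.V.fiber y₀) * Module.finrank ℚ (D.V.fiber y₀), fun y =>
      mtRankAt_le_of_pathConnectedSpace D.toVHSData y₀ y⟩

end Summit.HodgeConjecture.HodgeConjecture.Theorems
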